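import Summits.BirchSwinnertonDyer.BirchSwinnertonDyer.Theorems.UniversalToricDescentLowerHalfOfPoitouTate
import Summits.BirchSwinnertonDyer.BirchSwinnertonDyer.Theorems.UniversalToricDescentTwinChoiceByName
import HarnessLib

/-!
# Route `UniversalToricDescent`, rev 24: the HARD half of the twin rung (`MissingLowerBoundAt W 3`) from the route's CURRENT items
# {20186, 20692, 20693 ✓, 20694, 23594, 23595 ✓, 20385} + PT1 + the twist's r = 0 upper half — crux #5 (20386) not needed

Cell `bsd-wall` (W-ALL row 2·3@3, lane 3), seat `bsd-wall-utd-p3` (prover, gen 6), 2026-08-28 (`--supports stmt-BirchSwinnertonDyer-20386`).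
Sequel of `Theorems/UniversalToricDescentLowerHalfOfPoitouTate.lean` (this seat, p593492), whose lower-half kernel was stated with the
RETIRED parent crux #3 `TwinSplitIMCAtThree` (20214, aside since rev 24). Here the same kernel is re-keyed to utd-p2's twin-choice
currency (`UniversalToricDescentTwinChoice.TwinIMCAtThreeAt W′` at the handed twin, p576995 / p579882) and to the rev-24 bucket items
BY NAME, exactly as the route kernel `ToricKernelAtThreeApZero` (23596 ✓, utd-p1 g8) does for `BSD₃`:

* §1 `missingLowerBoundAt_three_of_twinIMCAtThreeAt_of_controlLe_of_twistUpper` — pointwise (handed twin `W′`, `TwinIMCAtThreeAt W′`).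
* §2 `missingLowerBoundAt_three_of_apZero_of_cellSupply_of_controlLe_of_twistUpper` — the `a₃ = 0` half of bucket C + the supply on the
  cell + buckets A (print, closed child) / B, trichotomy as in `UniversalToricDescentTwinChoice.bsdp_three_of_apZero_of_cellSupply`.
* §3 BY NAME: **`missingLowerBoundAt_three_towerSurj_of_apZeroBuckets_of_poitouTate_of_katoTam`** — `ToricPublishedInputs → 20186 → 20692 →
  20693 → 20694 → 23594 → 23595 → 20385 → (∀ K, PT1 K) → A161″ ⟹ ∀ W (cell, TowerSurjThree, twin), MissingLowerBoundAt W 3`; and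
  `missingLowerBoundAt_three_of_apZeroBuckets_of_poitouTate_of_wildRankZeroTwist` (20387 instead of Kato; all twin rows).

READING (PARTITION, class currency): with the route's `closes (hF hT h3 hsupply hV hC hZ hK)` as reference, the main-conjecture half
`MissingLowerBoundAt W 3` of the leaf `WAllExclAddWildRankOneSurjTwin` needs every item of `closes` EXCEPT hC (crux #5, replaced by the
by-name fact PT1 = leaf 20461) — and on the tower-surjective rows (census: 3 894/3 894 of the onto wild r = 1 classes) not even hZ.

HONEST FRAMING: CONDITIONAL on the displayed antecedents; theorems only; closes no item by name; BSD₃ is proved for no curve; the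
UPPER half of the rung still needs hC's `≥` direction (hence `poitouTate_sha_tateDual`) and hZ's hard half.

References: [JetchevSkinnerWan2017] §7.4.1, Thm. 3.3.1; [MilneADT2006] I Thm. 4.10(b); [Kato2004Asterisque] Thm. 14.5 (3), Prop. 14.16 (2);
[GrossZagier1986] Thm. I.(6.3), (7.3), V.§2; [FriedbergHoffstein1995] Thm. B; [Miller2011LMS] Def. 1.1.
-/

noncomputable section

open scoped Classical

set_option linter.dupNamespace false
set_option autoImplicit false

namespace Summit.BirchSwinnertonDyer.BirchSwinnertonDyer.Theorems.UniversalToricDescentLowerHalf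

open WeierstrassCurve NumberField IsDedekindDomain Field
  Literature.NumberTheory.EllipticCurves
  Literature.NumberTheory.EllipticCurves.ModularForms
  Literature.NumberTheory.EllipticCurves.Rank1Residual
  Literature.NumberTheory.EllipticCurves.Rank1Residual.Typed
  Literature.NumberTheory.EllipticCurves.KrizLi2019
  Literature.NumberTheory.GaloisRepresentations
  Literature.NumberTheory.GaloisCohomology
  Summit.BirchSwinnertonDyer.Rank1Residual
  Summit.BirchSwinnertonDyer.Rank1Residual.Additive
  Summit.BirchSwinnertonDyer.Rank1Residual.X11b
  Summit.BirchSwinnertonDyer.Rank1Residual.X11b.AcSelmer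
  Summit.BirchSwinnertonDyer.Rank1Residual.X11b.Halves
  Summit.BirchSwinnertonDyer.BirchSwinnertonDyer.Theses.UniversalToricDescent
  Summit.BirchSwinnertonDyer.BirchSwinnertonDyer.Theorems.SchneiderFreeControlAtoms
  Summit.BirchSwinnertonDyer.BirchSwinnertonDyer.Theorems.AdditiveRankOneControlLe
  Summit.BirchSwinnertonDyer.BirchSwinnertonDyer.Theorems.UniversalToricDescentTwinChoice

/-! ## §1 The pointwise lower-half kernel at a handed twin -/

/-- **Pointwise lower-half kernel (rev-24 shape).** As `missingLowerBoundAt_three_of_transport_of_controlLe_of_twistUpper_at`,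
but crux #3 enters POINTWISE at the handed semistable twin `W′` as `UniversalToricDescentTwinChoice.TwinIMCAtThreeAt W′` (utd-p2's
twin-choice kernel currency, p576995/p579882: the Friedberg–Hoffstein field has `2` split, so `d_K` is odd) instead of the retired
parent `TwinSplitIMCAtThree` (20214, aside). Published inputs → transport → Waldspurger frame → [`≤`-control at every frame of
every Heegner datum of `W`] → [r = 0 UPPER half of the odd Heegner twists of `W`] ⟹ `MissingLowerBoundAt W 3`. NO control equality,
NO co-STEP L, NO rank-zero wild leaf. [cite: JetchevSkinnerWan2017, §7.4.1 (arXiv:1512.06894 p. 30)]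
[cite: GrossZagier1986, Thm. I.(6.3), (7.3) and V.§2] [cite: FriedbergHoffstein1995, Thm. B] [cite: Miller2011LMS, Def. 1.1] -/
theorem missingLowerBoundAt_three_of_twinIMCAtThreeAt_of_controlLe_of_twistUpper
    (hF : ToricPublishedInputs) (hT : ToricTransportModThree)
    (hV : WildSplitWaldspurgerAtThree) (W : WeierstrassCurve ℚ) [W.IsElliptic] [W.IsGloballyMinimal]
    (hO6 : ClassO6 W 3) (hr : W.analyticRank = 1) (hsurj : W.HasSurjectiveModNGaloisRep 3)
    (W' : WeierstrassCurve ℚ) [W'.IsElliptic] [W'.IsGloballyMinimal]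
    (hcong : O6.ModPCongruent W' W 3) (hW'ss : ¬ Addv W' 3) (hI' : TwinIMCAtThreeAt W')
    (R : WeierstrassCurve ℚ → Prop) (hR : R W)
    (hCle : ∀ (W : WeierstrassCurve ℚ) [W.IsElliptic] [W.IsGloballyMinimal] (N : ℕ) [NeZero N] (K : Type)
      [Field K] [NumberField K] (Dt : ModularParametrizationData W N)
      (H : HeegnerDatum N (NumberField.discr K)) (ι : K →+* ℂ) (P : (W.baseChange K).toAffine.Point),
      ClassO6 W 3 → W.HasSurjectiveModNGaloisRep 3 → W.analyticRank = 1 → W.conductorNorm ℤ = N →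
      IsImaginaryQuadratic K → SatisfiesHeegnerHypothesis N K →
      (W.quadraticTwist (NumberField.discr K : ℚ)).entireLFunction 1 ≠ 0 →
      WeierstrassCurve.Affine.Point.map ι.toRatAlgHom P = heegnerPointComplex Dt H →
      ¬ IsOfFinAddOrder P → kolyvagin N W K →
      ∀ (κ : ZpExtension K 3), κ.IsAnticyclotomic →
        ∀ (γ : Field.absoluteGaloisGroup K) [Fact (κ.IsTopGenerator γ)]
          (𝔭 : HeightOneSpectrum (𝓞 K)) (h𝔭 : ((3 : ℕ) : 𝓞 K) ∈ 𝔭.asIdeal)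
          (he : 𝔭.asIdeal.ramificationIdx (𝓞 ℚ) = 1) (hf : 𝔭.asIdeal.inertiaDeg (𝓞 ℚ) = 1),
          AdditiveControlLeOnTreeAt 3 κ 𝔭 γ (embAt K 3 𝔭 h𝔭 he hf) 0 P)
    (hTwUp : ∀ (W : WeierstrassCurve ℚ) [W.IsElliptic] [W.IsGloballyMinimal] (N : ℕ) [NeZero N] (K : Type)
      [Field K] [NumberField K] (Wd : WeierstrassCurve ℚ) [Wd.IsElliptic] [Wd.IsGloballyMinimal],
      ClassO6 W 3 → W.HasSurjectiveModNGaloisRep 3 → W.analyticRank = 1 → R W → W.conductorNorm ℤ = N →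
      IsImaginaryQuadratic K → SatisfiesHeegnerHypothesis N K → Odd (NumberField.discr K) →
      (∃ C : VariableChange ℚ, C • W.quadraticTwist (NumberField.discr K : ℚ) = Wd) →
      (W.quadraticTwist (NumberField.discr K : ℚ)).entireLFunction 1 ≠ 0 → MissingUpperBoundAt Wd 3) :
    MissingLowerBoundAt W 3 := by
  obtain ⟨hGZ, hKo, hGZK, hmod, hmodP, -, hGZ73, hFH, hpar, hHP⟩ := hF
  haveI hN0 : NeZero (W.conductorNorm ℤ) := ⟨W.conductorNorm_pos_holds.ne'⟩
  haveI hN0' : NeZero (W'.conductorNorm ℤ) := ⟨W'.conductorNorm_pos_holds.ne'⟩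
  -- (a) DATA. parity: `r_an = 1` is odd, so `w(E) = -1`
  have hw : W.rootNumber = -1 := by
    rcases W.rootNumber_eq_one_or with h | h
    · exfalso
      have heven : Even W.analyticRank := (hpar W).mpr h
      rw [hr] at heven
      exact Nat.not_even_one heven
    · exact h
  -- Friedberg–Hoffstein with auxiliary modulus `2·N(E′)`: Heegner for `N(E)`, `N(E′)`, and `2` split
  obtain ⟨K, _, _, hK, -, hHN, hH2N', hLt⟩ :=
    hFH W hw (2 * W'.conductorNorm ℤ) (mul_ne_zero two_ne_zero hN0'.out) 0
  have hHN' : SatisfiesHeegnerHypothesis (W'.conductorNorm ℤ) K :=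
    SatisfiesHeegnerHypothesis.of_dvd (dvd_mul_left _ 2) hH2N'
  have hodd : Odd (NumberField.discr K) := by
    have h8 := Literature.SatisfiesHeegnerHypothesis.discr_emod_eight hK.1 hH2N' (dvd_mul_right 2 _)
    rw [Int.odd_iff]; omega
  -- `3 ∣ N(E)` (additive) splits in `K`; `3 ∤ #𝓞_K^×`
  have h3N : 3 ∣ W.conductorNorm ℤ :=
    (W.dvd_conductorNorm_iff_not_hasGoodReductionAtPrime 3).mpr (not_good_of_addv W 3 hO6.2.1)
  have hsplit : SplitsIn K 3 := hHN 3 Nat.prime_three h3N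
  have hunit : ¬ 3 ∣ Units.torsionOrder K :=
    (X11b.Three.not_dvd_discr_and_not_dvd_torsionOrder_of_heegner hK hHN (p := 3) (by decide) h3N).2
  -- the Heegner point over `K` and its data; non-torsion by Gross–Zagier
  obtain ⟨P, Dt, H, ι, hP⟩ := hHP W K hK hHN
  have hL0 : W.entireLFunction 1 = 0 := entireLFunction_one_eq_zero_of_analyticRank_eq_one hr
  obtain ⟨-, hderiv⟩ := leadingLCoeff_eq_deriv_of_analyticRank_eq_one hr
  have hLK : LDerivEK W K ≠ 0 := by
    rw [lDerivEK_eq_deriv_mul W K hmod hL0]; exact mul_ne_zero hderiv hLt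
  have hnt : ¬ IsOfFinAddOrder P :=
    (lDerivEK_ne_zero_iff_not_isOfFinAddOrder W (W.conductorNorm ℤ) K (hGZ _ W K) hK hHN
      ⟨Dt, H, ι, hP⟩).mp hLK
  -- Kolyvagin: `rank E(K) = 1`, `Ш(E/K)` finite
  obtain ⟨hrk, hfin⟩ := hKo (W.conductorNorm ℤ) W K hK hHN ⟨Dt, H, ι, hP⟩ hnt
  -- the twin's parametrisation datum (modularity)
  obtain ⟨Dt'⟩ := hmodP W'
  -- a frame `(κ, γ, 𝔭)` and the other prime `𝔭′ ≠ 𝔭` above `3`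
  obtain ⟨κ, γ, -, hκ, hγ, -⟩ := X11b.exists_anticyclotomic_generator_prime (p := 3) hK
  haveI : Fact (κ.IsTopGenerator γ) := ⟨hγ⟩
  obtain ⟨𝔭, h𝔭, he, hf⟩ := X11b.exists_degreeOnePrime_of_splitsIn K 3 hK.1 hsplit
  obtain ⟨𝔭', hne, h𝔭', he', hf'⟩ := X11b.Three.exists_ne_degreeOne_prime hK.1 h𝔭 he hf
  -- (b) PLUMBING. Waldspurger frame and unit value at `(κ, γ, 𝔭)`
  obtain ⟨ι', hind, ΩK, Ωp, L, hΩK, hΩp, hBDP, u, hval⟩ :=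
    hV W (W.conductorNorm ℤ) K Dt H ι P hO6 hsurj hr rfl hK hHN hLt hP hnt κ hκ γ 𝔭 h𝔭 he hf
  -- the twin's IMC at `(ι′, 𝔭)` with `X_ac` strict at `𝔭′` — the pointwise hypothesis at the handed twin
  obtain ⟨hex', hall'⟩ :=
    hI' (W'.conductorNorm ℤ) K Dt' rfl hK hHN' hodd κ hκ γ 𝔭 h𝔭 he hf 𝔭' h𝔭' hne ι' hind
  -- transport: IMC EQUALITY for `E` at the frame `L`
  have heq : (XAc.charIdeal (W.baseChange K) 3 κ 𝔭' ∅ γ).map (PowerSeries.map (toUnr 3)) =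
      Ideal.span {L} :=
    hT W W' (W.conductorNorm ℤ) (W'.conductorNorm ℤ) K Dt Dt' hO6 hsurj hr rfl hcong hW'ss rfl hK hHN
      hHN' κ hκ γ 𝔭 h𝔭 he hf 𝔭' h𝔭' hne ι' hind hex' hall' ΩK Ωp L hΩK hΩp hBDP
  -- the `≤` half of control at `𝔭′` (CTL₀ included) — supplier
  obtain ⟨n, hn, hnle⟩ := hCle W (W.conductorNorm ℤ) K Dt H ι P hO6 hsurj hr rfl hK hHN hLt hP hnt
    (hKo _ W K) κ hκ γ 𝔭' h𝔭' he' hf'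
  -- the value read through the logarithm at `𝔭′` (rank one: `(log_{𝔭′} P)² = (log_𝔭 P)²`)
  have hval' : L.HasValueAt 0 ((((u : unrIntegers 3) : unrIntegers 3) : ℂ_[3]) *
      (algebraMap ℚ_[3] ℂ_[3]
        (logOmega W 3 (embAt K 3 𝔭' h𝔭' he' hf') P / (Dt.c : ℚ_[3]))) ^ 2) :=
    (SchneiderFreeAdditiveX3.hasValueAt_sq_logOmega_embAt_iff_of_rank_one W 3 hK.1 hrk h𝔭 he hf
      h𝔭' he' hf' P _ _ L).mpr hval
  -- the LOWER socket at slack `v₃(c)` at the frame `(κ, 𝔭′, γ, embAt 𝔭′)`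
  have hc0 : Dt.c ≠ 0 := Dt.maninConstant_ne_zero_holds
  have hlog : logOmega W 3 (embAt K 3 𝔭' h𝔭' he' hf') P ≠ 0 := X11b.R1.logOmega_ne_zero W 3 _ hnt
  have hlow : SchneiderFree.AdditiveIMCLowerBDPOnTreeLeAt 3 κ 𝔭' γ (embAt K 3 𝔭' h𝔭' he' hf')
      (padicValNat 3 Dt.c.natAbs) P := by
    -- the LOWER norm receptacle (`⊆` + value): `2·ord₃(log_{𝔭′}P / c) ≤ ord₃ f(0)`
    obtain ⟨htors, f, hfI, hf0, hfn⟩ := hn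
    have hmem : PowerSeries.map (toUnr 3) f ∈ Ideal.span {L} := by
      have h3 := heq.le
      rw [hfI, CongruenceLimit.map_span_singleton_powerSeries] at h3
      exact (Ideal.span_singleton_le_iff_mem _).mp h3
    obtain ⟨-, hle⟩ := Supersingular.two_mul_valuation_le_of_mem_span 3 hf0 hmem u hval'
    have hc0' : (Dt.c : ℚ_[3]) ≠ 0 := by exact_mod_cast hc0
    rw [div_eq_mul_inv, Padic.valuation_mul hlog (inv_ne_zero hc0'), Padic.valuation_inv,
      Padic.valuation_intCast, valuation_logOmega hlog, hfn] at hle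
    refine ⟨n, ⟨htors, f, hfI, hf0, hfn⟩, ?_⟩
    simp only [padicValInt] at hle
    linarith
  -- STEP L at slack `v₃(c)` by the `≤` link (NO control equality)
  have hlo : SchneiderFree.IndexLowerBoundLeAt W 3 K P (padicValNat 3 Dt.c.natAbs) :=
    indexLowerBoundLeAt_of_imcLowerLe_of_controlLe_zero rfl hK hHN hfin hlow ⟨n, hn, hnle⟩
  -- (c) a globally minimal model of the twist, the JOINT lower half, minus the twist's upper half
  have hD0 : (NumberField.discr K : ℚ) ≠ 0 := by exact_mod_cast NumberField.discr_ne_zero K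
  haveI : (W.quadraticTwist (NumberField.discr K : ℚ)).IsElliptic := W.isElliptic_quadraticTwist hD0
  obtain ⟨Cd, hCd⟩ := hasGlobalMinimalModel_rat_holds (W.quadraticTwist (NumberField.discr K : ℚ))
  haveI : (Cd • W.quadraticTwist (NumberField.discr K : ℚ)).IsGloballyMinimal := hCd
  have hJ : JointLowerBoundAt W (Cd • W.quadraticTwist (NumberField.discr K : ℚ)) 3 :=
    SchneiderFree.Exact.jointLowerBoundAt_of_stepL_manin hGZ hKo hGZK hmod hGZ73 W 3 (W.conductorNorm ℤ) K
      Dt H ι P (Cd • W.quadraticTwist (NumberField.discr K : ℚ)) hr rfl h3N hK hodd hunit hHN hLt hP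
      ⟨Cd, rfl⟩ (by decide) hlo
  exact missingLowerBoundAt_of_joint_of_upper hJ
    (hTwUp W (W.conductorNorm ℤ) K (Cd • W.quadraticTwist (NumberField.discr K : ℚ)) hO6 hsurj hr hR rfl hK hHN hodd
      ⟨Cd, rfl⟩ hLt)

/-! ## §2 The rev-24 buckets: the `a₃ = 0` half of bucket C and the supply on the cell -/

/-- **The r = 1 LOWER half on the twin rung from the rev-24 bucket structure, a `≤`-control supplier and a twist-upper supplier**
— utd-p2's `bsdp_three_of_apZero_of_cellSupply` (trichotomy of the handed twin at `3`; good-supersingular twins traded for the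
supplied `a₃ = 0` twin, onto by transport; bucket A by the printed facts through the closed child; bucket B by its crux) with the
pointwise kernel replaced by §1. Row predicate `R` arbitrary (the twist-upper supplier may use it). [folklore] -/
theorem missingLowerBoundAt_three_of_apZero_of_cellSupply_of_controlLe_of_twistUpper (R : WeierstrassCurve ℚ → Prop)
    (hF : ToricPublishedInputs) (hT : ToricTransportModThree) (hP : TwinSplitIMCAtThreePrintedFacts)
    (hA : TwinSplitIMCAtThreeGoodOrdOfPrint) (hB : TwinSplitIMCAtThreeMult)
    (hS0 : ∀ (W' : WeierstrassCurve ℚ) [W'.IsElliptic] [W'.IsGloballyMinimal],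
      GoodSS W' 3 → W'.frobeniusTrace 3 = 0 → W'.HasSurjectiveModNGaloisRep 3 → TwinIMCAtThreeAt W')
    (hsupply : ∀ (W : WeierstrassCurve ℚ) [W.IsElliptic] [W.IsGloballyMinimal], ClassO6 W 3 →
      W.analyticRank = 1 → W.HasSurjectiveModNGaloisRep 3 → HasGoodSSTwinAtThree W →
      HasGoodSSApZeroTwinAtThree W)
    (hV : WildSplitWaldspurgerAtThree)
    (hCle : ∀ (W : WeierstrassCurve ℚ) [W.IsElliptic] [W.IsGloballyMinimal] (N : ℕ) [NeZero N] (K : Type)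
      [Field K] [NumberField K] (Dt : ModularParametrizationData W N)
      (H : HeegnerDatum N (NumberField.discr K)) (ι : K →+* ℂ) (P : (W.baseChange K).toAffine.Point),
      ClassO6 W 3 → W.HasSurjectiveModNGaloisRep 3 → W.analyticRank = 1 → W.conductorNorm ℤ = N →
      IsImaginaryQuadratic K → SatisfiesHeegnerHypothesis N K →
      (W.quadraticTwist (NumberField.discr K : ℚ)).entireLFunction 1 ≠ 0 →
      WeierstrassCurve.Affine.Point.map ι.toRatAlgHom P = heegnerPointComplex Dt H →
      ¬ IsOfFinAddOrder P → kolyvagin N W K →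
      ∀ (κ : ZpExtension K 3), κ.IsAnticyclotomic →
        ∀ (γ : Field.absoluteGaloisGroup K) [Fact (κ.IsTopGenerator γ)]
          (𝔭 : HeightOneSpectrum (𝓞 K)) (h𝔭 : ((3 : ℕ) : 𝓞 K) ∈ 𝔭.asIdeal)
          (he : 𝔭.asIdeal.ramificationIdx (𝓞 ℚ) = 1) (hf : 𝔭.asIdeal.inertiaDeg (𝓞 ℚ) = 1),
          AdditiveControlLeOnTreeAt 3 κ 𝔭 γ (embAt K 3 𝔭 h𝔭 he hf) 0 P)
    (hTwUp : ∀ (W : WeierstrassCurve ℚ) [W.IsElliptic] [W.IsGloballyMinimal] (N : ℕ) [NeZero N] (K : Type)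
      [Field K] [NumberField K] (Wd : WeierstrassCurve ℚ) [Wd.IsElliptic] [Wd.IsGloballyMinimal],
      ClassO6 W 3 → W.HasSurjectiveModNGaloisRep 3 → W.analyticRank = 1 → R W → W.conductorNorm ℤ = N →
      IsImaginaryQuadratic K → SatisfiesHeegnerHypothesis N K → Odd (NumberField.discr K) →
      (∃ C : VariableChange ℚ, C • W.quadraticTwist (NumberField.discr K : ℚ) = Wd) →
      (W.quadraticTwist (NumberField.discr K : ℚ)).entireLFunction 1 ≠ 0 → MissingUpperBoundAt Wd 3) :
    ∀ (W : WeierstrassCurve ℚ) [W.IsElliptic] [W.IsGloballyMinimal], ClassO6 W 3 →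
      W.analyticRank = 1 → W.HasSurjectiveModNGaloisRep 3 → R W →
      (∃ (W' : WeierstrassCurve ℚ) (_ : W'.IsElliptic) (_ : W'.IsGloballyMinimal),
        O6.ModPCongruent W' W 3 ∧ ¬ Addv W' 3 ∧ W'.HasSurjectiveModNGaloisRep 3) → MissingLowerBoundAt W 3 := by
  intro W _ _ hO6 hr hsurj hR htwin
  obtain ⟨W', hW'e, hW'm, hcong, hW'ss, hW'surj⟩ := htwin
  by_cases hgood : W'.HasGoodReductionAtPrime 3
  · by_cases hss : (3 : ℤ) ∣ W'.frobeniusTrace 3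
    · -- good supersingular: trade `W′` for the supplied `a₃ = 0` twin `W″`
      obtain ⟨W'', hW''e, hW''m, hcong'', hW''ss, ha0⟩ :=
        hsupply W hO6 hr hsurj ⟨W', hW'e, hW'm, hcong, hgood, by exact_mod_cast hss⟩
      have hW''surj : W''.HasSurjectiveModNGaloisRep 3 := by
        obtain ⟨e, he⟩ := hcong''
        refine GaloisImage.hasSurjectiveModNGaloisRep_of_torsionIso e.symm (fun σ Q ↦ ?_) hsurj
        apply e.injective
        rw [he, e.apply_symm_apply, e.apply_symm_apply]
      exact missingLowerBoundAt_three_of_twinIMCAtThreeAt_of_controlLe_of_twistUpper hF hT hV W hO6 hr hsurj W'' hcong''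
        (fun h ↦ h.1 hW''ss.1) (hS0 W'' hW''ss ha0 hW''surj) R hR hCle hTwUp
    · -- good ordinary: bucket A by the printed facts through the closed child
      refine missingLowerBoundAt_three_of_twinIMCAtThreeAt_of_controlLe_of_twistUpper hF hT hV W hO6 hr hsurj W' hcong
        hW'ss ?_ R hR hCle hTwUp
      intro N' _ K _ _ Dt' hN hK hH hodd κ hκ γ _ 𝔭 h𝔭 he hf 𝔭' h𝔭' hne ι' hι
      exact hA hP.1 hP.2.1 hP.2.2 W' N' K Dt' ⟨hgood, by exact_mod_cast hss⟩ hW'surj hN hK hH hodd κ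
        hκ γ 𝔭 h𝔭 he hf 𝔭' h𝔭' hne ι' hι
  · -- multiplicative: bucket B
    have hmult : W'.HasMultiplicativeReductionAtPrime 3 := by
      by_contra h
      exact hW'ss ⟨hgood, h⟩
    exact missingLowerBoundAt_three_of_twinIMCAtThreeAt_of_controlLe_of_twistUpper hF hT hV W hO6 hr hsurj W' hcong hW'ss
      (twinSplitIMCAtThreeMult_iff.1 hB W' hmult hW'surj) R hR hCle hTwUp

/-! ## §3 BY NAME in the route's rev-24 items: the lower half of the twin rung ⟸ {20186, 20692, 20693, 20694, 23594, 23595, 20385}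
## ∪ {PT1} ∪ print, on the tower-surjective rows (Kato) — resp. ∪ {20387} on all rows -/

/-- **The HARD half of the twin rung on its `3`-adic TOWER-SURJECTIVE rows, in the route's rev-24 items BY NAME**:
`ToricPublishedInputs → ToricTransportModThree (20186) → TwinSplitIMCAtThreePrintedFacts (20692) → TwinSplitIMCAtThreeGoodOrdOfPrint
(20693 ✓) → TwinSplitIMCAtThreeMult (20694) → TwinSplitIMCAtThreeGoodSSApZero (23594) → GoodSSApZeroTwinSupplyAtThree (23595 ✓) →
WildSplitWaldspurgerAtThree (20385) → (∀ K, poitouTate_selmerStructure_duality K) → Kato A161″ → ∀ W, ClassO6 W 3 → r_an = 1 →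
ρ̄₃ onto → TowerSurjThree W → (semistable onto twin) → MissingLowerBoundAt W 3`. NOT used: crux #5 `WildSplitControlAtThree`
(20386; its `≤` half comes from PT1, `wildSplitControlLeAtThree_of_poitouTate`), `poitouTate_sha_tateDual`, Serre / Fin_v, the
rank-zero wild leaf `WildRankZeroTwistAtThree` (20387). [cite: JetchevSkinnerWan2017, §7.4.1 (arXiv:1512.06894 p. 30)]
[cite: Kato2004Asterisque, Thm. 14.5 (3) (p. 236) and Prop. 14.16 (2) (p. 244)] [cite: MilneADT2006, Ch. I, Thm. 4.10(b)] -/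
theorem missingLowerBoundAt_three_towerSurj_of_apZeroBuckets_of_poitouTate_of_katoTam
    (hF : ToricPublishedInputs) (hT : ToricTransportModThree) (hP : TwinSplitIMCAtThreePrintedFacts)
    (hA : TwinSplitIMCAtThreeGoodOrdOfPrint) (hB : TwinSplitIMCAtThreeMult)
    (hS0 : TwinSplitIMCAtThreeGoodSSApZero) (hsupply : GoodSSApZeroTwinSupplyAtThree)
    (hV : WildSplitWaldspurgerAtThree)
    (hPT : ∀ (K : Type) [Field K] [NumberField K], poitouTate_selmerStructure_duality K)
    (hKatoT : Kato2004.rankZero_padicValNat_sha_add_padicValNat_tamagawa_le_of_additive_potGood_of_imageContainsSL2) :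
    ∀ (W : WeierstrassCurve ℚ) [W.IsElliptic] [W.IsGloballyMinimal], ClassO6 W 3 → W.analyticRank = 1 →
      W.HasSurjectiveModNGaloisRep 3 → AdditiveThree.TowerSurjThree W →
      (∃ (W' : WeierstrassCurve ℚ) (_ : W'.IsElliptic) (_ : W'.IsGloballyMinimal),
        O6.ModPCongruent W' W 3 ∧ ¬ Addv W' 3 ∧ W'.HasSurjectiveModNGaloisRep 3) →
      MissingLowerBoundAt W 3 := by
  have hGZK : rank_eq_analyticRank_of_analyticRank_le_one := hF.2.2.1
  have hmod : hasEntireLFunction_rat := hF.2.2.2.1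
  exact missingLowerBoundAt_three_of_apZero_of_cellSupply_of_controlLe_of_twistUpper AdditiveThree.TowerSurjThree hF hT hP hA hB
    (fun W' _ _ hss ha hsurj N' _ K _ _ Dt' hN hK hH hodd κ hκ γ _ 𝔭 h𝔭 he hf 𝔭' h𝔭' hne ι' hι ↦
      hS0 W' N' K Dt' hss ha hsurj hN hK hH hodd κ hκ γ 𝔭 h𝔭 he hf 𝔭' h𝔭' hne ι' hι)
    (fun W _ _ hO6 hr hsurj htwin ↦ hsupply W hO6 hr hsurj htwin) hV
    (wildSplitControlLeAtThree_of_poitouTate hPT)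
    (fun W _ _ N _ K _ _ Wd _ _ hO6 _hsurj _hr hTow hN hK hHN _hodd hC hLt ↦
      UniversalToricDescentWaldspurgerFlat.missingUpperBoundAt_twist_of_towerSurj_of_katoTam 3 (by decide) hKatoT
        hGZK hmod W hO6.2.1 hO6.padicValRat_j_nonneg
        (UniversalToricDescentWaldspurgerFlat.forall_hasSurjectiveModNGaloisRep_pow_three_of_towerSurjThree W hTow)
        hN K hK hHN Wd hC hLt)

/-- **The HARD half of the twin rung on ALL its rows from the rev-24 items + PT1 + the rank-zero wild leaf** (the twist's upper
half read off `WildRankZeroTwistAtThree` 20387): compared with the route's `closes`, crux #5 (20386) is the ONLY item dropped, and it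
is dropped entirely. [cite: JetchevSkinnerWan2017, §7.4.1 (arXiv:1512.06894 p. 30)] [cite: MilneADT2006, Ch. I, Thm. 4.10(b)] -/
theorem missingLowerBoundAt_three_of_apZeroBuckets_of_poitouTate_of_wildRankZeroTwist
    (hF : ToricPublishedInputs) (hT : ToricTransportModThree) (hP : TwinSplitIMCAtThreePrintedFacts)
    (hA : TwinSplitIMCAtThreeGoodOrdOfPrint) (hB : TwinSplitIMCAtThreeMult)
    (hS0 : TwinSplitIMCAtThreeGoodSSApZero) (hsupply : GoodSSApZeroTwinSupplyAtThree)
    (hV : WildSplitWaldspurgerAtThree)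
    (hPT : ∀ (K : Type) [Field K] [NumberField K], poitouTate_selmerStructure_duality K)
    (hZ : WildRankZeroTwistAtThree) :
    ∀ (W : WeierstrassCurve ℚ) [W.IsElliptic] [W.IsGloballyMinimal], ClassO6 W 3 → W.analyticRank = 1 →
      W.HasSurjectiveModNGaloisRep 3 →
      (∃ (W' : WeierstrassCurve ℚ) (_ : W'.IsElliptic) (_ : W'.IsGloballyMinimal),
        O6.ModPCongruent W' W 3 ∧ ¬ Addv W' 3 ∧ W'.HasSurjectiveModNGaloisRep 3) →
      MissingLowerBoundAt W 3 := by
  intro W _ _ hO6 hr hsurj htwin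
  have hGZK : rank_eq_analyticRank_of_analyticRank_le_one := hF.2.2.1
  exact missingLowerBoundAt_three_of_apZero_of_cellSupply_of_controlLe_of_twistUpper (fun _ ↦ True) hF hT hP hA hB
    (fun W' _ _ hss ha hsurj N' _ K _ _ Dt' hN hK hH hodd κ hκ γ _ 𝔭 h𝔭 he hf 𝔭' h𝔭' hne ι' hι ↦
      hS0 W' N' K Dt' hss ha hsurj hN hK hH hodd κ hκ γ 𝔭 h𝔭 he hf 𝔭' h𝔭' hne ι' hι)
    (fun W _ _ hO6 hr hsurj htwin ↦ hsupply W hO6 hr hsurj htwin) hV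
    (wildSplitControlLeAtThree_of_poitouTate hPT)
    (fun W _ _ N _ K _ _ Wd _ _ hO6 hsurj _hr _ hN hK hHN hodd hC hLt ↦
      missingUpperBoundAt_twist_of_wildRankZeroTwist hGZK hZ W hO6 hsurj hN K hK hHN hodd Wd hC hLt)
    W hO6 hr hsurj trivial htwin

end Summit.BirchSwinnertonDyer.BirchSwinnertonDyer.Theorems.UniversalToricDescentLowerHalf

end
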